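import Summits.ValiantsHypothesis.ValiantsHypothesis.Theorems.LacunarySymmetroidMatrixDescartesStubVLaw
import Summits.ValiantsHypothesis.ValiantsHypothesis.Theorems.LacunarySymmetroidMatrixDescartesFirstRung
import Summits.ValiantsHypothesis.ValiantsHypothesis.Theorems.LacunarySymmetroidMatrixDescartesCensusPivotBridge
import Summits.ValiantsHypothesis.ValiantsHypothesis.Theorems.LacunarySymmetroidMatrixDescartesPivotArrowTwo

/-!
# `MatrixDescartes` census — the `K = 2` PIVOT COLUMN IS EXACT AT EVERY SIZE AND EVERY INDEX:
# `PivotRootLawAt m 2 q (2m)` unconditionally, and `PivotRootLawAt m 2 q B ↔ 2m ≤ B` for `m, q ≥ 1`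

HONEST FRAMING.  Cell `pub-symmetroid`, seat `val-sym-mdr-p2` (gen 9); helper file `--supports` the crux
`Theses.LacunarySymmetroid.MatrixDescartes` (stmt-ValiantsHypothesis-18050, OPEN, on HOLD), NO closure claim.  Pure
bookkeeping over results already in the tree, in conjb-1's pivot currency (`…CensusPivotDefs`: `PivotRootLawAt m K q B` =
«every `m × m` pivot pencil `X^e • J + X^{d₀} • P₀ + X^{d₁} • P₁` with `J` symmetric of negative index `≤ q` and
`P₀, P₁ ⪰ 0` has at most `B` distinct positive determinant zeros»):

* UPPER side `Z₊ ≤ 2m` for EVERY symmetric `J` (no index hypothesis is used): if the pivot exponent separates the two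
  letters (`d₀ < e < d₁` or `d₁ < e < d₀`) this is the V-LAW `stub_vLaw` (this seat's g0–g2, `…StubVLaw`, from the fan
  laws `…FanLaw` and the degree count `…VLawDegree`); otherwise the pencil is one-sided and `firstRung_oneSided`
  (`…FirstRung`) gives `Z₊ ≤ m`.  Hence `pivotPosRoots_twoLetters_le` and **`pivotRootLawAt_two_all (m q) :
  PivotRootLawAt m 2 q (2m)`**.
* LOWER side: `not_pivotRootLawAt_two_one` (`…PivotArrowTwo`, g8: an index-ONE arrowhead pencil with `2m` roots, every
  `m ≥ 1`), transported to every index `q ≥ 1` by `Pivot.pivotRootLawAt_of_le_index` (`…CensusPivotBridge`).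
* Together **`pivotRootLawAt_two_iff : PivotRootLawAt m 2 q B ↔ 2m ≤ B`** (`1 ≤ m`, `1 ≤ q`): the first conjunct of
  g8's `indexOne_columns_sharp_of_bilinear` no longer needs the typed bilinear guess `RankOnePivotLawBilinear` — the
  `K = 2` column of the pivot table equals the bilinear budget `2(m−1)(K−1) + 2 = 2m` UNCONDITIONALLY, at every index.
  (At index `0` the pivot is `⪰ 0` and the row is not sharp; we state only the upper side there.)

Nothing here bears on `MatrixDescartes` in its window, on `stub_twoSided`, on `DoorA26` / `DoorA34`, the census
registers / credences, or on `VP ≠ VNP`.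

[folklore] Case split + three tree theorems.  No definitions, no named facts.
-/

set_option linter.dupNamespace false

namespace Summit.ValiantsHypothesis.ValiantsHypothesis.Theorems.LacunarySymmetroidMatrixDescartes

open scoped BigOperators
open Polynomial

/-- **Two PSD letters around ANY symmetric pivot: `Z₊ ≤ 2m`.**  For `J` real symmetric `m × m`, `P₀, P₁ ⪰ 0` and
arbitrary exponents `e, d₀, d₁`, `det (X^e • J + X^{d₀} • P₀ + X^{d₁} • P₁)` has at most `2m` distinct positive zeros
(V-law `stub_vLaw` when `e` separates `d₀, d₁`; one-sided first rung `firstRung_oneSided` otherwise). [folklore] -/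
theorem pivotPosRoots_twoLetters_le (m e : ℕ) (d : Fin 2 → ℕ) (J : Matrix (Fin m) (Fin m) ℝ)
    (P : Fin 2 → Matrix (Fin m) (Fin m) ℝ) (hJ : J.IsSymm) (hP : ∀ k, (P k).PosSemidef) :
    Pivot.pivotPosRoots e d J P ≤ 2 * m := by
  classical
  unfold Pivot.pivotPosRoots
  by_cases hone : (∀ k, e ≤ d k) ∨ (∀ k, d k ≤ e)
  · have h := firstRung_oneSided (Fin m) (Fin 2) e d J P hJ hP hone
    simp only [Fintype.card_fin] at h
    omega
  · -- the pivot exponent strictly separates the two letters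
    have hsep : (d 0 < e ∧ e < d 1) ∨ (d 1 < e ∧ e < d 0) := by
      rcases Nat.lt_or_ge (d 0) e with h0 | h0 <;> rcases Nat.lt_or_ge (d 1) e with h1 | h1
      · exact (hone (Or.inr (Fin.forall_fin_two.mpr ⟨h0.le, h1.le⟩))).elim
      · rcases Nat.lt_or_ge e (d 1) with h1' | h1'
        · exact Or.inl ⟨h0, h1'⟩
        · exact (hone (Or.inr (Fin.forall_fin_two.mpr ⟨h0.le, h1'⟩))).elim
      · rcases Nat.lt_or_ge e (d 0) with h0' | h0'
        · exact Or.inr ⟨h1, h0'⟩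
        · exact (hone (Or.inr (Fin.forall_fin_two.mpr ⟨h0', h1.le⟩))).elim
      · exact (hone (Or.inl (Fin.forall_fin_two.mpr ⟨h0, h1⟩))).elim
    have hsum : ((X : ℝ[X]) ^ e) • J.map Polynomial.C + ∑ k, ((X : ℝ[X]) ^ d k) • (P k).map Polynomial.C
        = ((X : ℝ[X]) ^ e) • J.map Polynomial.C + ((X : ℝ[X]) ^ d 0) • (P 0).map Polynomial.C
          + ((X : ℝ[X]) ^ d 1) • (P 1).map Polynomial.C := by
      rw [Fin.sum_univ_two, add_assoc]
    rcases hsep with ⟨h0, h1⟩ | ⟨h1, h0⟩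
    · have h := stub_vLaw (Fin m) e (d 0) (d 1) J (P 0) (P 1) hJ (hP 0) (hP 1) h0 h1
      rw [hsum]
      simpa only [Fintype.card_fin] using h
    · have h := stub_vLaw (Fin m) e (d 1) (d 0) J (P 1) (P 0) hJ (hP 1) (hP 0) h1 h0
      have hsum' : ((X : ℝ[X]) ^ e) • J.map Polynomial.C + ∑ k, ((X : ℝ[X]) ^ d k) • (P k).map Polynomial.C
          = ((X : ℝ[X]) ^ e) • J.map Polynomial.C + ((X : ℝ[X]) ^ d 1) • (P 1).map Polynomial.C
            + ((X : ℝ[X]) ^ d 0) • (P 0).map Polynomial.C := by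
        rw [hsum]; abel
      rw [hsum']
      simpa only [Fintype.card_fin] using h

/-- **THE `K = 2` PIVOT COLUMN, UPPER SIDE, UNCONDITIONALLY: `PivotRootLawAt m 2 q (2m)` for all `m, q`.**
(The index hypothesis is not even used.) [folklore] -/
theorem pivotRootLawAt_two_all (m q : ℕ) : Pivot.PivotRootLawAt m 2 q (2 * m) :=
  fun e d J P hJ hP _ => pivotPosRoots_twoLetters_le m e d J P hJ hP

/-- Lower side at every positive index: `¬ PivotRootLawAt m 2 q (2m − 1)` for `m, q ≥ 1` (g8's index-one arrowhead
witness `not_pivotRootLawAt_two_one` (`…PivotArrowTwo`), moved up the index by `Pivot.pivotRootLawAt_of_le_index`).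
[folklore] -/
theorem not_pivotRootLawAt_two_sub_one {m q : ℕ} (hm : 1 ≤ m) (hq : 1 ≤ q) :
    ¬ Pivot.PivotRootLawAt m 2 q (2 * m - 1) := by
  intro h
  obtain ⟨r, rfl⟩ := Nat.exists_eq_add_of_le hq
  exact not_pivotRootLawAt_two_one hm (Pivot.pivotRootLawAt_of_le_index h)

/-- **THE `K = 2` PIVOT COLUMN IS EXACT: `PivotRootLawAt m 2 q B ↔ 2m ≤ B`** for every `m ≥ 1` and every index
`q ≥ 1` — the value `2m = 2(m−1)(K−1) + 2` of the `K = 2` column, with no appeal to the typed bilinear guess.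
[folklore] -/
theorem pivotRootLawAt_two_iff {m q : ℕ} (hm : 1 ≤ m) (hq : 1 ≤ q) (B : ℕ) :
    Pivot.PivotRootLawAt m 2 q B ↔ 2 * m ≤ B := by
  refine ⟨fun h => ?_, fun hB => Pivot.pivotRootLawAt_mono (pivotRootLawAt_two_all m q) hB⟩
  by_contra hB
  exact not_pivotRootLawAt_two_sub_one hm hq (Pivot.pivotRootLawAt_mono h (by omega))

/-- The `K = 2` instance of the typed bilinear guess holds: `PivotRootLawAt m 2 1 (2(m−1)(2−1) + 2)` for every `m`
(bookkeeping form matching `Pivot.RankOnePivotLawBilinear m 2`). [bookkeeping] -/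
theorem rankOnePivotLawBilinear_at_two (m : ℕ) : Pivot.PivotRootLawAt m 2 1 (2 * (m - 1) * (2 - 1) + 2) := by
  refine Pivot.pivotRootLawAt_mono (pivotRootLawAt_two_all m 1) ?_
  rcases m with _ | m
  · simp
  · simp only [Nat.add_sub_cancel]
    omega

end Summit.ValiantsHypothesis.ValiantsHypothesis.Theorems.LacunarySymmetroidMatrixDescartes
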